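import Literature.Analysis.FluidPDE.ElgindiBlowupContinuationProofs
import Literature.Analysis.FluidPDE.BiotSavartRepresentation
import Literature.Analysis.FluidPDE.LipschitzSqIntegrableDecay
import HarnessLib

/-!
# Slices of Hölder-class Euler solutions are Biot–Savart velocities of their vorticity

Analysis/FluidPDE support file (all results proved, no definitions) on the decomposition path of
`Literature.Analysis.FluidPDE.MajdaBertozzi2002_holderEulerUniqueness` (`ElgindiAprioriBlowupProofs.lean`).
In the solution class `IsHolderEulerSolution γ S u₀ u p` of `ElgindiBlowupContinuationProofs.lean`
(classical Euler solution on `ℝ³`, slices `C^{1,γ}` with finite energy and compactly supported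
vorticity) every slice is recovered from its vorticity by the Biot–Savart law,
`u(t) = K₃ * curl u(t)` (`IsHolderEulerSolution.biotSavart_curl_slice`): the discharged fact
`biotSavart_curl_eq_self` (`BiotSavartRepresentation.lean`; Majda–Bertozzi Prop. 2.16) applies
because a `C^{1,γ}` finite-energy field vanishes at infinity
(`MemC1Holder.tendsto_cocompact_of_hasFiniteEnergy`, `LipschitzSqIntegrableDecay.lean`) and a
continuous compactly supported vorticity is integrable and bounded. This is the sentence "with
finite energy and compactly supported vorticity `u(t)` is the Biot–Savart velocity of `ω(t)`" of
the docstrings of `MajdaBertozzi2002_holderEulerContinuation` and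
`MajdaBertozzi2002_holderEulerUniqueness`, now a theorem; the velocity of a solution in the class
is thereby determined by its vorticity (`IsHolderEulerSolution.slice_eq_of_curl_eq`).

## References

* A. J. Majda, A. L. Bertozzi, *Vorticity and Incompressible Flow* (CUP 2002), §2.4.1
  Prop. 2.16; §4.1 (4.2)–(4.4) (the velocity of the Lagrangian solution is the Biot–Savart
  velocity of its vorticity). [MajdaBertozziCUP2002]
-/

noncomputable section

open MeasureTheory Set Filter Topology Function
open scoped NNReal

namespace Literature.Analysis.FluidPDE

/-- **A `C^{1,γ}` finite-energy divergence-free field with compactly supported vorticity is the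
Biot–Savart velocity of its vorticity**, `v = K₃ * curl v` (the discharged
`biotSavart_curl_eq_self` with its hypotheses supplied: `v → 0` at infinity by
`MemC1Holder.tendsto_cocompact_of_hasFiniteEnergy`; `curl v` is continuous with compact support,
hence integrable and bounded). [cite: MajdaBertozziCUP2002, §2.4.1 Prop. 2.16 (p. 63–64 of the held text)] -/
theorem MemC1Holder.biotSavart_curl_eq {γ : ℝ≥0}
    {v : EuclideanSpace ℝ (Fin 3) → EuclideanSpace ℝ (Fin 3)} (hv : MemC1Holder γ v)
    (hdiv : VectorCalculus.IsDivFree v) (hE : HasFiniteEnergy v)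
    (hsupp : HasCompactSupport (curl v)) : biotSavart (curl v) = v := by
  have hωc : Continuous (curl v) := continuous_curl hv.1
  obtain ⟨C, hC⟩ := hωc.bounded_above_of_compact_support hsupp
  exact biotSavart_curl_eq_self_holds v hv.1 hdiv (hv.tendsto_cocompact_of_hasFiniteEnergy hE)
    (hωc.integrable_of_hasCompactSupport hsupp) ⟨C, hC⟩

variable {γ : ℝ≥0} {S : Set ℝ} {u₀ : EuclideanSpace ℝ (Fin 3) → EuclideanSpace ℝ (Fin 3)}
  {u : ℝ → EuclideanSpace ℝ (Fin 3) → EuclideanSpace ℝ (Fin 3)}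
  {p : ℝ → EuclideanSpace ℝ (Fin 3) → ℝ}

/-- The slices of a solution in the Hölder class are divergence free on `ℝ³`. [folklore] -/
theorem IsHolderEulerSolution.isDivFree_slice (h : IsHolderEulerSolution γ S u₀ u p) {t : ℝ}
    (ht : t ∈ S) : VectorCalculus.IsDivFree (u t) := fun x =>
  h.euler.divFree t ht x (TopologicalSpace.Opens.mem_top x)

/-- **Every slice of a Hölder-class Euler solution is the Biot–Savart velocity of its vorticity**:
`u(t) = K₃ * curl u(t)` for `t ∈ S`. [cite: MajdaBertozziCUP2002, §2.4.1 Prop. 2.16; §4.1 (4.2)–(4.4)] -/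
theorem IsHolderEulerSolution.biotSavart_curl_slice (h : IsHolderEulerSolution γ S u₀ u p) {t : ℝ}
    (ht : t ∈ S) : biotSavart (curl (u t)) = u t :=
  MemC1Holder.biotSavart_curl_eq (h.slice t ht).1 (h.isDivFree_slice ht) (h.slice t ht).2.1
    (h.slice t ht).2.2

/-- **The velocity of a Hölder-class solution is determined by its vorticity**: two solutions of
the class (possibly with different data and pressures) whose vorticities agree at a common time
have the same velocity at that time. [folklore] -/
theorem IsHolderEulerSolution.slice_eq_of_curl_eq {S' : Set ℝ}
    {u₀' : EuclideanSpace ℝ (Fin 3) → EuclideanSpace ℝ (Fin 3)}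
    {u' : ℝ → EuclideanSpace ℝ (Fin 3) → EuclideanSpace ℝ (Fin 3)}
    {p' : ℝ → EuclideanSpace ℝ (Fin 3) → ℝ} (h : IsHolderEulerSolution γ S u₀ u p)
    (h' : IsHolderEulerSolution γ S' u₀' u' p') {t : ℝ} (ht : t ∈ S) (ht' : t ∈ S')
    (hcurl : curl (u t) = curl (u' t)) : u t = u' t := by
  rw [← h.biotSavart_curl_slice ht, ← h'.biotSavart_curl_slice ht', hcurl]

end Literature.Analysis.FluidPDE
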